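import Mathlib.Data.Real.Basic
import Mathlib.Tactic.Linarith
import Mathlib.Tactic.Ring
import Mathlib.Tactic.FieldSimp
import Mathlib.Tactic.Positivity
import Mathlib.Tactic.LinearCombination
import HarnessLib

/-!
# QUANT lane R8, T-DEC, leg (III), blob case — `LawDec.GatedSliceMixLaw'`, the residual cell `MixLawCellA5r`: the scalar
# inequality behind the offer condition of the filling routing (two Positivstellensatz certificates and a quadratic interpolation)

builds on p205010 (kernel theorem, internal audit signed; external expert review pending)

Support file (`--supports stmt-CriticalPhenomena-4575`), QUANT lane seat prim-quant-arm-3 (gen 116), rung R8 of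
`run/shared/lean/prim/quant/LADDER.md`, task `quant/WAKE-arm-3-g33-A5R.md` (lead g33).  Pure real-arithmetic lemmas (no law,
no flow), kept apart from the routing files so that the cell theorem (`…QuantGatedSliceMixLawA5rHolds`) elaborates fast.

NOTATION (lead g33 / `…A5Fill`): lengths `k₁`, `a`, `k₂` (reals here), the shifted low `ℓ = k₁ + a`, `d = k₂ − ℓ`, `G = k₂ + a`,
`t` the threshold, `y` the floor, `g` the gate; `p = t − 2k₁`, `q = k₂ + k₁ − t`, `w = t − 2ℓ`, `s = t − yG`; the light closed
form of the usage of the mid `k₂` by the low `ℓ` is `U = N/(d − N)` with `N = y²d + (1 − y)w` and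
`d − N = (1 − y)((1 − y)ℓ + (1 + y)k₂ − t)` (`usage_eq_light'`).

THE MATHEMATICS.  The lead's load bound (LB) `t·q·U ≤ (t − ℓ)·p` is FALSE in the residual corner (witness `y = 41/60, z = 1/4,
g = 41/45, S = 47/3, λ = 17/18, a = 3, j = M = k₂ = 22, k₁ = 2`: all hypotheses of `MixLawCellA5r` hold, `t q U = 174.62 > r p = 174.43`),
but the exact offer condition (OFF) of `decAtT_movedTwoPoint_of_fill` — equivalently the lead's (E) — holds.  Dividing by `1 − z`,
(E) reads `(1 − λ)·X ≤ λ·Y` with `X = t q g U + k₁p(1 − g) − (t − ℓ)p g`, `Y = (1 − g)k₁(2k₂ − t) + g p (t/y − G) ≥ 0`, and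
unsaturation of the mid reads `(1 − λ) g U ≤ λ(1 − g)`; hence (E) follows from the `λ`-FREE and `(1 − z)`-FREE inequality
  (U)  `(1 − g)·X ≤ g·U·Y`,
which (multiplied by `y(d − N) > 0`) is `p · (−y·Q(g)) ≥ 0` for the quadratic
  `y·Q(g) = y k₁(d − N) + g·y·(N(k₂ + k₁ − a) − d(t − a + k₁)) − g²·(N(t − 2ay) − y d (t − a))`
(`a5r_U`).  `Q(0) = k₁(d − N) ≥ 0` and `y·Q(1) = N(yG − t) ≤ 0`, so `{g ∈ [0,1] : Q(g) ≤ 0}` is an interval containing `1` and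
`Q(g) ≤ 0` on `[max(y, k₁/a), 1]` iff it holds at the left end (`a5r_core`, Lagrange interpolation at `0, m, 1`):
* `a5r_V1` (`k₁ ≤ ya`, `g = y`): `−Q(y) = (1−y)³(d(ya − k₁) + k₁w) + y(1−y)³sw + y²(1−y)²(ds + 2sw) + y³(1−y)(ad + 2ds + sw) + y⁴ds`;
* `a5r_V2m` (`ya ≤ k₁ = ma`, `g = m`): a 24-term certificate in `y, m − y, 1 − m` times products of `a, d, w, s`
  (kit job j190343, scipy/HiGHS LP, exact rational reconstruction; both identities re-verified by `ring` below).
Censuses (seat folder `work/explore/`): (U) 13 836 / 0 on the exact corner sampler; V1, V2 0 / 3.8·10⁵ on the minimal regions.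
HONEST STATUS: with `…A5rHolds` the residual cell `MixLawCellA5r` and hence `MixLawCellA5` are theorems; `MixLawCellQ4/QH/QK`,
regime B, `GatedSliceMixLaw'`, CW, `GateMove`, `TreeDEC`, `FarTreeRow` OPEN; RATE class log* / honest sentence unchanged.

[this work].  Nothing here is cited as a published result.
-/

namespace Summit.CriticalPhenomena.PercolationContinuityZ3.Theorems

namespace Quant

namespace LawDec

/-- `N = y²d + (1−y)w`, the numerator of the light usage closed form (`d = k₂ − k₁ − a`, `w = t − 2(k₁ + a)`). -/
local notation3 "NL[" k₁ ", " a ", " k₂ ", " t ", " y "]" =>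
  ((y : ℝ) ^ 2 * ((k₂ : ℝ) - k₁ - a) + (1 - y) * (t - 2 * (k₁ + a)))

/-- `y·Q(g)`, the quadratic in the gate `g` whose sign decides the offer condition (file header). -/
local notation3 "YQ[" k₁ ", " a ", " k₂ ", " t ", " y ", " g "]" =>
  ((y : ℝ) * k₁ * (((k₂ : ℝ) - k₁ - a) - NL[k₁, a, k₂, t, y])
    + g * y * (NL[k₁, a, k₂, t, y] * (k₂ + k₁ - a) - (k₂ - k₁ - a) * (t - a + k₁))
    - g ^ 2 * (NL[k₁, a, k₂, t, y] * (t - 2 * a * y) - y * (k₂ - k₁ - a) * (t - a)))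

/-- **Piece V1** (`k₁ ≤ ya`, gate at its floor value `g = y`): `y·Q(y) ≤ 0`, by the explicit Positivstellensatz certificate
`−Q(y) = (1−y)³(d(ya − k₁) + k₁w) + y(1−y)³sw + y²(1−y)²(ds + 2sw) + y³(1−y)(ad + 2ds + sw) + y⁴ds`
(`d = k₂ − k₁ − a`, `w = t − 2(k₁+a)`, `s = t − y(k₂ + a)`, all nonnegative). [this work] -/
theorem a5r_V1 (k₁ a k₂ t y : ℝ) (hk₁ : 0 ≤ k₁) (ha : 0 ≤ a) (hd : k₁ + a ≤ k₂) (hw : 2 * (k₁ + a) ≤ t)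
    (hy0 : 0 ≤ y) (hy1 : y ≤ 1) (hs : y * (k₂ + a) ≤ t) (hsig : k₁ ≤ y * a) :
    YQ[k₁, a, k₂, t, y, y] ≤ 0 := by
  set D : ℝ := k₂ - k₁ - a with hD
  set W : ℝ := t - 2 * (k₁ + a) with hW
  set S : ℝ := t - y * (k₂ + a) with hS
  set E : ℝ := y * a - k₁ with hE
  set F : ℝ := 1 - y with hF
  have hD0 : 0 ≤ D := by rw [hD]; linarith
  have hW0 : 0 ≤ W := by rw [hW]; linarith
  have hS0 : 0 ≤ S := by rw [hS]; linarith
  have hE0 : 0 ≤ E := by rw [hE]; linarith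
  have hF0 : 0 ≤ F := by rw [hF]; linarith
  have hcert : YQ[k₁, a, k₂, t, y, y]
      = -(y * (F ^ 3 * (D * E + k₁ * W) + y * F ^ 3 * (S * W) + y ^ 2 * F ^ 2 * (D * S + 2 * (S * W))
          + y ^ 3 * F * (a * D + 2 * (D * S) + S * W) + y ^ 4 * (D * S))) := by
    rw [hD, hW, hS, hE, hF]; ring
  have hpos : 0 ≤ y * (F ^ 3 * (D * E + k₁ * W) + y * F ^ 3 * (S * W) + y ^ 2 * F ^ 2 * (D * S + 2 * (S * W))
      + y ^ 3 * F * (a * D + 2 * (D * S) + S * W) + y ^ 4 * (D * S)) := by positivity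
  rw [hcert]; linarith

/-- **Piece V2** (`ya ≤ k₁ = ma < a`, gate at its smallness floor `g = m = k₁/a`): `y·Q(m) ≤ 0`, by a 24-term Positivstellensatz
certificate in the nonnegative quantities `y, m − y, 1 − m, a, d, w, s` (kit job j190343; `−(y/m)Q(m) =
sw(m−y)(1−y)³ + y(1−m)³(aw + sw) + y(m−y)(1−m)²(2ad + aw + 5sw) + y(m−y)²(1−m)(2ad + 7sw) + 3y(m−y)³sw + y²(1−m)²(ds + 2sw)
+ y²(m−y)(1−m)(2ds + 5sw) + y²(m−y)²(ds + 3sw) + y³(1−m)(ad + 2ds + sw) + y³(m−y)(2ds + sw) + y⁴ds`). [this work] -/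
theorem a5r_V2m (m a k₂ t y : ℝ) (ha : 0 ≤ a) (hd : m * a + a ≤ k₂) (hw : 2 * (m * a + a) ≤ t)
    (hy0 : 0 ≤ y) (hym : y ≤ m) (hm1 : m ≤ 1) (hs : y * (k₂ + a) ≤ t) :
    YQ[m * a, a, k₂, t, y, m] ≤ 0 := by
  set D : ℝ := k₂ - m * a - a with hD
  set W : ℝ := t - 2 * (m * a + a) with hW
  set S : ℝ := t - y * (k₂ + a) with hS
  set E : ℝ := m - y with hE
  set F : ℝ := 1 - m with hF
  have hm0 : 0 ≤ m := le_trans hy0 hym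
  have hD0 : 0 ≤ D := by rw [hD]; linarith
  have hW0 : 0 ≤ W := by rw [hW]; linarith
  have hS0 : 0 ≤ S := by rw [hS]; linarith
  have hE0 : 0 ≤ E := by rw [hE]; linarith
  have hF0 : 0 ≤ F := by rw [hF]; linarith
  have hcert : YQ[m * a, a, k₂, t, y, m]
      = -(m * (S * W * E * (F + E) ^ 3 + y * F ^ 3 * (a * W + S * W) + y * E * F ^ 2 * (2 * (a * D) + a * W + 5 * (S * W))
          + y * E ^ 2 * F * (2 * (a * D) + 7 * (S * W)) + 3 * (y * E ^ 3 * (S * W)) + y ^ 2 * F ^ 2 * (D * S + 2 * (S * W))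
          + y ^ 2 * E * F * (2 * (D * S) + 5 * (S * W)) + y ^ 2 * E ^ 2 * (D * S + 3 * (S * W))
          + y ^ 3 * F * (a * D + 2 * (D * S) + S * W) + y ^ 3 * E * (2 * (D * S) + S * W) + y ^ 4 * (D * S))) := by
    rw [hD, hW, hS, hE, hF]; ring
  have hpos : 0 ≤ m * (S * W * E * (F + E) ^ 3 + y * F ^ 3 * (a * W + S * W) + y * E * F ^ 2 * (2 * (a * D) + a * W + 5 * (S * W))
          + y * E ^ 2 * F * (2 * (a * D) + 7 * (S * W)) + 3 * (y * E ^ 3 * (S * W)) + y ^ 2 * F ^ 2 * (D * S + 2 * (S * W))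
          + y ^ 2 * E * F * (2 * (D * S) + 5 * (S * W)) + y ^ 2 * E ^ 2 * (D * S + 3 * (S * W))
          + y ^ 3 * F * (a * D + 2 * (D * S) + S * W) + y ^ 3 * E * (2 * (D * S) + S * W) + y ^ 4 * (D * S)) := by
    positivity
  rw [hcert]; linarith

/-- **The core: `y·Q(g) ≤ 0` for every admissible gate.**  Frame: `0 ≤ k₁`, `0 < a`, `k₁ + a ≤ k₂`, `2(k₁ + a) ≤ t ≤ k₁ + a + k₂`,
`0 < y < 1`, `y(k₂ + a) ≤ t`; gate `y ≤ g ≤ 1` with `k₁ < a g`.  Proof: `Q` is quadratic in `g` with `y·Q(0) = y k₁(d − N) ≥ 0`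
and `y·Q(1) = N(yG − t) ≤ 0`; Lagrange interpolation at `0, m, 1` with `m = max(y, k₁/a)` and the pieces `a5r_V1` / `a5r_V2m`.
[this work] -/
theorem a5r_core (k₁ a k₂ t y g : ℝ) (hk₁ : 0 ≤ k₁) (ha : 0 < a) (hd : k₁ + a ≤ k₂) (hw : 2 * (k₁ + a) ≤ t)
    (hcomp : t ≤ k₁ + a + k₂) (hy0 : 0 < y) (hy1 : y < 1) (hg1 : g ≤ 1) (hyg : y ≤ g) (hsmall : k₁ < a * g)
    (hs : y * (k₂ + a) ≤ t) :
    YQ[k₁, a, k₂, t, y, g] ≤ 0 := by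
  -- the values at g = 0 and g = 1
  have hN0 : 0 ≤ NL[k₁, a, k₂, t, y] := by
    have h1 : 0 ≤ y ^ 2 * (k₂ - k₁ - a) := mul_nonneg (sq_nonneg y) (by linarith)
    have h2 : 0 ≤ (1 - y) * (t - 2 * (k₁ + a)) := mul_nonneg (by linarith) (by linarith)
    linarith
  have hDN : 0 ≤ (k₂ - k₁ - a) - NL[k₁, a, k₂, t, y] := by
    have e : (k₂ - k₁ - a) - NL[k₁, a, k₂, t, y] = (1 - y) * (((k₁ + a) + k₂ - t) + y * (k₂ - k₁ - a)) := by ring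
    rw [e]
    exact mul_nonneg (by linarith) (by nlinarith)
  have hQ0 : 0 ≤ YQ[k₁, a, k₂, t, y, (0 : ℝ)] := by
    have e : YQ[k₁, a, k₂, t, y, (0 : ℝ)] = y * k₁ * ((k₂ - k₁ - a) - NL[k₁, a, k₂, t, y]) := by ring
    rw [e]; exact mul_nonneg (mul_nonneg hy0.le hk₁) hDN
  have hQ1 : YQ[k₁, a, k₂, t, y, (1 : ℝ)] ≤ 0 := by
    have e : YQ[k₁, a, k₂, t, y, (1 : ℝ)] = -(NL[k₁, a, k₂, t, y] * (t - y * (k₂ + a))) := by ring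
    rw [e]
    have : 0 ≤ NL[k₁, a, k₂, t, y] * (t - y * (k₂ + a)) := mul_nonneg hN0 (by linarith)
    linarith
  -- Lagrange interpolation at 0, m, 1: m(1−m)·YQ(g) = −(1−m)(g−m)(1−g)·YQ(0) + g(1−g)·YQ(m) + m g (g−m)·YQ(1)
  have interp : ∀ m : ℝ, 0 < m → m < 1 → m ≤ g → YQ[k₁, a, k₂, t, y, m] ≤ 0 → YQ[k₁, a, k₂, t, y, g] ≤ 0 := by
    intro m hm0 hm1 hmg hQm
    have e : m * (1 - m) * YQ[k₁, a, k₂, t, y, g]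
        = -((1 - m) * (g - m) * (1 - g) * YQ[k₁, a, k₂, t, y, (0 : ℝ)]) + g * (1 - g) * YQ[k₁, a, k₂, t, y, m]
          + m * g * (g - m) * YQ[k₁, a, k₂, t, y, (1 : ℝ)] := by
      ring
    have hg0 : 0 ≤ g := le_trans hm0.le hmg
    have h1 : 0 ≤ (1 - m) * (g - m) * (1 - g) * YQ[k₁, a, k₂, t, y, (0 : ℝ)] :=
      mul_nonneg (mul_nonneg (mul_nonneg (by linarith) (by linarith)) (by linarith)) hQ0
    have h2 : g * (1 - g) * YQ[k₁, a, k₂, t, y, m] ≤ 0 :=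
      mul_nonpos_of_nonneg_of_nonpos (mul_nonneg hg0 (by linarith)) hQm
    have h3 : m * g * (g - m) * YQ[k₁, a, k₂, t, y, (1 : ℝ)] ≤ 0 :=
      mul_nonpos_of_nonneg_of_nonpos (mul_nonneg (mul_nonneg hm0.le hg0) (by linarith)) hQ1
    have h4 : m * (1 - m) * YQ[k₁, a, k₂, t, y, g] ≤ 0 := by rw [e]; linarith
    have hmm : 0 < m * (1 - m) := mul_pos hm0 (by linarith)
    by_contra hc
    have : 0 < m * (1 - m) * YQ[k₁, a, k₂, t, y, g] := mul_pos hmm (not_le.1 hc)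
    linarith
  by_cases hya : k₁ ≤ y * a
  · -- m = y
    exact interp y hy0 hy1 hyg (a5r_V1 k₁ a k₂ t y hk₁ ha.le hd hw hy0.le hy1.le hs hya)
  · -- m = k₁ / a
    have hya' : y * a < k₁ := lt_of_not_ge hya
    set m : ℝ := k₁ / a with hm
    have hma : m * a = k₁ := by rw [hm]; field_simp
    have hk₁0 : 0 < k₁ := lt_of_le_of_lt (mul_nonneg hy0.le ha.le) hya'
    have hm0 : 0 < m := div_pos hk₁0 ha
    have hm1 : m < 1 := by
      rw [hm, div_lt_one ha]; nlinarith
    have hmg : m ≤ g := by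
      rw [hm, div_le_iff₀ ha]; linarith
    have hym : y ≤ m := by
      rw [hm, le_div_iff₀ ha]; linarith
    refine interp m hm0 hm1 hmg ?_
    have hV2 := a5r_V2m m a k₂ t y ha.le (by rw [hma]; linarith) (by rw [hma]; linarith) hy0.le hym hm1.le hs
    rw [hma] at hV2
    exact hV2

/-- **The usage form (U)** consumed by `…A5rHolds`: with `U` the light usage of the mid `k₂` by the shifted low `k₁ + a`
(characterised by `U·(d − N) = N`, `usage_eq_light'`), under the frame of `a5r_core` (with `t < k₁ + a + k₂` strict),
`(1 − g)·y·(t q g U + k₁ p (1 − g) − (t − ℓ) p g) ≤ g·U·((1 − g) k₁ (2k₂ − t) y + g p (t − y(k₂ + a)))`,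
`p = t − 2k₁`, `q = k₂ + k₁ − t`, `ℓ = k₁ + a`.  Proof: `(RHS − LHS)·(d − N) = p·(−y·Q(g))` and `a5r_core`. [this work] -/
theorem a5r_U (k₁ a k₂ t y g U : ℝ) (hk₁ : 0 ≤ k₁) (ha : 0 < a) (hd : k₁ + a ≤ k₂) (hw : 2 * (k₁ + a) ≤ t)
    (hcomp : t < k₁ + a + k₂) (hy0 : 0 < y) (hy1 : y < 1) (hg1 : g ≤ 1) (hyg : y ≤ g) (hsmall : k₁ < a * g)
    (hs : y * (k₂ + a) ≤ t)
    (hU : U * ((1 - y) * ((1 - y) * (k₁ + a) + (1 + y) * k₂ - t)) = y ^ 2 * (k₂ - k₁ - a) + (1 - y) * (t - 2 * (k₁ + a))) :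
    (1 - g) * (y * (t * (k₂ + k₁ - t) * g * U + k₁ * (t - 2 * k₁) * (1 - g) - (t - (k₁ + a)) * (t - 2 * k₁) * g))
      ≤ g * U * ((1 - g) * k₁ * (2 * k₂ - t) * y + g * (t - 2 * k₁) * (t - y * (k₂ + a))) := by
  have core := a5r_core k₁ a k₂ t y g hk₁ ha hd hw hcomp.le hy0 hy1 hg1 hyg hsmall hs
  set den : ℝ := (1 - y) * ((1 - y) * (k₁ + a) + (1 + y) * k₂ - t) with hden
  have hden0 : 0 < den := by
    rw [hden]
    apply mul_pos (by linarith)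
    have : 0 ≤ y * (k₂ - k₁ - a) := mul_nonneg hy0.le (by linarith)
    nlinarith
  have hp0 : 0 < t - 2 * k₁ := by linarith
  -- (RHS − LHS)·den = p·(−YQ) + coef·(U·den − N), and U·den = N
  have e : (g * U * ((1 - g) * k₁ * (2 * k₂ - t) * y + g * (t - 2 * k₁) * (t - y * (k₂ + a)))
        - (1 - g) * (y * (t * (k₂ + k₁ - t) * g * U + k₁ * (t - 2 * k₁) * (1 - g) - (t - (k₁ + a)) * (t - 2 * k₁) * g))) * den
      = (t - 2 * k₁) * (-(YQ[k₁, a, k₂, t, y, g])) := by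
    rw [hden]
    linear_combination (g * ((1 - g) * k₁ * (2 * k₂ - t) * y + g * (t - 2 * k₁) * (t - y * (k₂ + a)))
      - (1 - g) * y * t * (k₂ + k₁ - t) * g) * hU
  have h1 : 0 ≤ (t - 2 * k₁) * (-(YQ[k₁, a, k₂, t, y, g])) := mul_nonneg hp0.le (by linarith)
  by_contra hc
  have hneg : (g * U * ((1 - g) * k₁ * (2 * k₂ - t) * y + g * (t - 2 * k₁) * (t - y * (k₂ + a)))
        - (1 - g) * (y * (t * (k₂ + k₁ - t) * g * U + k₁ * (t - 2 * k₁) * (1 - g) - (t - (k₁ + a)) * (t - 2 * k₁) * g))) * den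
      < 0 := mul_neg_of_neg_of_pos (by linarith) hden0
  rw [e] at hneg
  linarith

end LawDec

end Quant

end Summit.CriticalPhenomena.PercolationContinuityZ3.Theorems
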